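import Mathlib
import Summits.MatrixMultiplication.MatrixMultiplication.Theorems.SoloBlindKraftDecomposition
import Summits.MatrixMultiplication.MatrixMultiplication.Theorems.SoloBlindKraftHyperplane

/-!
# Solo-blind seat (MatrixMultiplication), s68 — hyperplane-class steps of (K₃), outside patterns (1,0), (2,0), (1,1)
(TRIANGLE.md (R18.4), CLAIMS c650; brief `paper/KraftK3.md` §3(c); pattern (2,1) is `soloBlind_kraft_pattern21`)

With `q : G →+ ZMod 3` and `w` = the terms of `h` in `ker q`: if the terms outside `ker q` are
* one term `a` (`q (h a) = 1`): the Kraft bound for `h` follows from the Kraft bound `T1` for `w`;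
* two terms `a, b` on the same side (`q (h a) = q (h b) = 1`): from `T1` alone;
* two terms `a, c` on opposite sides (`q (h a) = 1`, `q (h c) = 2`): from `T1` and the Kraft bound `T2` for
  `w ∪ {h a + h c}` (a balanced block sum), in expanded form.
(Residue-2 variants follow by replacing `q` with `-q`.)  Together with (2,1) these are exactly the "3-flat" patterns for
which the induction step of (K₃) is a positive combination of Kraft bounds of shorter sub-sum sequences.
-/

set_option linter.dupNamespace false

namespace Summit.MatrixMultiplication.MatrixMultiplication.Theorems

open Finset BigOperators
open scoped Classical

section KraftHyperplaneFlat

variable {ι : Type*} {G : Type*} [AddCommGroup G]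

/-- Pattern (1,0): one term outside the hyperplane. -/
theorem soloBlind_kraft_pattern10 (s : Finset ι) (h : ι → G) (q : G →+ ZMod 3) (a : ι)
    (hu : (s.filter fun i => ¬ q (h i) = 0) = {a}) (hqa : q (h a) = 1)
    (T1 : ∀ σ, soloBlindKraft (s.filter fun i => q (h i) = 0) h σ ≤ 1)
    (τ : G) : soloBlindKraft s h τ ≤ 1 := by
  have key : soloBlindKraft s h τ = ∑ S ∈ (s.filter fun i => ¬ q (h i) = 0).powerset,
      (1/2 : ℚ) ^ S.card * soloBlindKraft (s.filter fun i => q (h i) = 0) h (τ - ∑ i ∈ S, h i) := by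
    convert soloBlindKraft_split s h (fun i => q (h i) = 0) τ
  rw [key, hu]
  set w := s.filter fun i => q (h i) = 0 with hw_def
  have hwK : ∀ i ∈ w, h i ∈ q.ker := fun i hi => by
    rw [AddMonoidHom.mem_ker]; exact (Finset.mem_filter.mp hi).2
  have van : ∀ σ, q σ ≠ 0 → soloBlindKraft w h σ = 0 := fun σ hσ =>
    soloBlindKraft_eq_zero_of_not_mem w h q.ker hwK (by rwa [AddMonoidHom.mem_ker])
  have nn : ∀ σ, 0 ≤ soloBlindKraft w h σ := fun σ => soloBlindKraft_nonneg w h σ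
  have hpa : ({a} : Finset ι).powerset = {∅, {a}} := by
    ext t; simp [Finset.subset_singleton_iff]
  have hne : (∅ : Finset ι) ≠ {a} := (Finset.singleton_ne_empty a).symm
  simp only [hpa, Finset.sum_pair hne, Finset.sum_empty, Finset.sum_singleton, Finset.card_empty,
    Finset.card_singleton, pow_zero, one_mul, sub_zero]
  norm_num
  have q4 : q (τ - h a) = q τ - 1 := by rw [map_sub, hqa]
  rcases soloBlind_zmod_three_cases (q τ) with h0 | h1 | h2
  · have z4 := van (τ - h a) (by rw [q4, h0]; decide)
    have t1 := T1 τ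
    linarith [z4]
  · have z0 := van τ (by rw [h1]; decide)
    have t1 := T1 (τ - h a)
    linarith [z0]
  · have z0 := van τ (by rw [h2]; decide)
    have z4 := van (τ - h a) (by rw [q4, h2]; decide)
    linarith [z0, z4]

/-- Pattern (2,0): two terms outside the hyperplane, on the same side. -/
theorem soloBlind_kraft_pattern20 (s : Finset ι) (h : ι → G) (q : G →+ ZMod 3) (a b : ι) (hab : a ≠ b)
    (hu : (s.filter fun i => ¬ q (h i) = 0) = {a, b}) (hqa : q (h a) = 1) (hqb : q (h b) = 1)
    (T1 : ∀ σ, soloBlindKraft (s.filter fun i => q (h i) = 0) h σ ≤ 1)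
    (τ : G) : soloBlindKraft s h τ ≤ 1 := by
  have key : soloBlindKraft s h τ = ∑ S ∈ (s.filter fun i => ¬ q (h i) = 0).powerset,
      (1/2 : ℚ) ^ S.card * soloBlindKraft (s.filter fun i => q (h i) = 0) h (τ - ∑ i ∈ S, h i) := by
    convert soloBlindKraft_split s h (fun i => q (h i) = 0) τ
  rw [key, hu]
  set w := s.filter fun i => q (h i) = 0 with hw_def
  have hwK : ∀ i ∈ w, h i ∈ q.ker := fun i hi => by
    rw [AddMonoidHom.mem_ker]; exact (Finset.mem_filter.mp hi).2
  have van : ∀ σ, q σ ≠ 0 → soloBlindKraft w h σ = 0 := fun σ hσ =>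
    soloBlindKraft_eq_zero_of_not_mem w h q.ker hwK (by rwa [AddMonoidHom.mem_ker])
  have nn : ∀ σ, 0 ≤ soloBlindKraft w h σ := fun σ => soloBlindKraft_nonneg w h σ
  have hnab : a ∉ ({b} : Finset ι) := by simp [hab]
  have hpb : ({b} : Finset ι).powerset = {∅, {b}} := by
    ext t; simp [Finset.subset_singleton_iff]
  have hne : (∅ : Finset ι) ≠ {b} := (Finset.singleton_ne_empty b).symm
  simp only [Finset.sum_powerset_insert hnab, hpb, Finset.sum_pair hne, Finset.insert_empty, Finset.sum_empty,
    Finset.sum_singleton, Finset.card_empty, Finset.card_singleton, Finset.sum_insert hnab,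
    Finset.card_insert_of_notMem hnab, pow_zero, one_mul, sub_zero]
  norm_num
  have q2 : q (τ - h b) = q τ - 1 := by rw [map_sub, hqb]
  have q4 : q (τ - h a) = q τ - 1 := by rw [map_sub, hqa]
  have q6 : q (τ - (h a + h b)) = q τ - 2 := by rw [map_sub, map_add, hqa, hqb]; ring
  rcases soloBlind_zmod_three_cases (q τ) with h0 | h1 | h2
  · have z2 := van (τ - h b) (by rw [q2, h0]; decide)
    have z4 := van (τ - h a) (by rw [q4, h0]; decide)
    have z6 := van (τ - (h a + h b)) (by rw [q6, h0]; decide)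
    have t1 := T1 τ
    linarith [z2, z4, z6]
  · have z0 := van τ (by rw [h1]; decide)
    have z6 := van (τ - (h a + h b)) (by rw [q6, h1]; decide)
    have t1 := T1 (τ - h a); have t1' := T1 (τ - h b)
    linarith [z0, z6]
  · have z0 := van τ (by rw [h2]; decide)
    have z2 := van (τ - h b) (by rw [q2, h2]; decide)
    have z4 := van (τ - h a) (by rw [q4, h2]; decide)
    have t1 := T1 (τ - (h a + h b))
    linarith [z0, z2, z4]

/-- Pattern (1,1): two terms outside the hyperplane, on opposite sides. -/
theorem soloBlind_kraft_pattern11 (s : Finset ι) (h : ι → G) (q : G →+ ZMod 3) (a c : ι) (hac : a ≠ c)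
    (hu : (s.filter fun i => ¬ q (h i) = 0) = {a, c}) (hqa : q (h a) = 1) (hqc : q (h c) = 2)
    (T1 : ∀ σ, soloBlindKraft (s.filter fun i => q (h i) = 0) h σ ≤ 1)
    (T2 : ∀ σ, soloBlindKraft (s.filter fun i => q (h i) = 0) h σ
        + (1/2 : ℚ) * soloBlindKraft (s.filter fun i => q (h i) = 0) h (σ - (h a + h c)) ≤ 1)
    (τ : G) : soloBlindKraft s h τ ≤ 1 := by
  have key : soloBlindKraft s h τ = ∑ S ∈ (s.filter fun i => ¬ q (h i) = 0).powerset,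
      (1/2 : ℚ) ^ S.card * soloBlindKraft (s.filter fun i => q (h i) = 0) h (τ - ∑ i ∈ S, h i) := by
    convert soloBlindKraft_split s h (fun i => q (h i) = 0) τ
  rw [key, hu]
  set w := s.filter fun i => q (h i) = 0 with hw_def
  have hwK : ∀ i ∈ w, h i ∈ q.ker := fun i hi => by
    rw [AddMonoidHom.mem_ker]; exact (Finset.mem_filter.mp hi).2
  have van : ∀ σ, q σ ≠ 0 → soloBlindKraft w h σ = 0 := fun σ hσ =>
    soloBlindKraft_eq_zero_of_not_mem w h q.ker hwK (by rwa [AddMonoidHom.mem_ker])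
  have nn : ∀ σ, 0 ≤ soloBlindKraft w h σ := fun σ => soloBlindKraft_nonneg w h σ
  have hnac : a ∉ ({c} : Finset ι) := by simp [hac]
  have hpc : ({c} : Finset ι).powerset = {∅, {c}} := by
    ext t; simp [Finset.subset_singleton_iff]
  have hne : (∅ : Finset ι) ≠ {c} := (Finset.singleton_ne_empty c).symm
  simp only [Finset.sum_powerset_insert hnac, hpc, Finset.sum_pair hne, Finset.insert_empty, Finset.sum_empty,
    Finset.sum_singleton, Finset.card_empty, Finset.card_singleton, Finset.sum_insert hnac,
    Finset.card_insert_of_notMem hnac, pow_zero, one_mul, sub_zero]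
  norm_num
  have q1 : q (τ - h c) = q τ - 2 := by rw [map_sub, hqc]
  have q4 : q (τ - h a) = q τ - 1 := by rw [map_sub, hqa]
  have q5 : q (τ - (h a + h c)) = q τ - 3 := by rw [map_sub, map_add, hqa, hqc]; ring
  rcases soloBlind_zmod_three_cases (q τ) with h0 | h1 | h2
  · have z1 := van (τ - h c) (by rw [q1, h0]; decide)
    have z4 := van (τ - h a) (by rw [q4, h0]; decide)
    have t2 := T2 τ
    have n5 := nn (τ - (h a + h c))
    linarith [z1, z4]
  · have z0 := van τ (by rw [h1]; decide)
    have z1 := van (τ - h c) (by rw [q1, h1]; decide)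
    have z5 := van (τ - (h a + h c)) (by rw [q5, h1]; decide)
    have t1 := T1 (τ - h a)
    linarith [z0, z1, z5]
  · have z0 := van τ (by rw [h2]; decide)
    have z4 := van (τ - h a) (by rw [q4, h2]; decide)
    have z5 := van (τ - (h a + h c)) (by rw [q5, h2]; decide)
    have t1 := T1 (τ - h c)
    linarith [z0, z4, z5]

end KraftHyperplaneFlat

end Summit.MatrixMultiplication.MatrixMultiplication.Theorems
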